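import Literature.Computability.Complexity.GateEliminationStanding
import Literature.Computability.Complexity.GateEliminationRegate
import Literature.Computability.Complexity.GateEliminationKResynth
import Literature.Computability.Complexity.GateEliminationDimension

/-!
# Gate elimination: the one-step claim of Li–Yang's Theorem 4.1 from Cases 5–8

`LiYang2022_step_of_cases5to8 : LiYang2022_cases5to8 → LiYang2022_step`: the case analysis of
ECCC TR21-023 §4.1 is carried out down to the standing assumptions of Case 5, with every step
proved:

* Case 0.1 (normalization): one application of Rule 1, 2/3, 5 (`rule1`, `rule23_any`,
  `rule5_any`, `rule_selfTwice`) or Rule 4 (`rule4`) simplifies the circuit (first branch);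
* Case 0.2 is a theorem for pre-normalized circuits (`reachesOut_of_preNormalized`);
* Case 0.3 (non-degeneracy): a degenerate gate of the acyclic part is eliminated by
  `eliminate_single_dependence`; a degenerate gate of the cyclic xor-part is constant or has a
  constant wire, and a constant gate of the xor-part is removed by re-synthesis
  (`resynth_const_xorGate`) — first branch;
* Case 0.4: a non-empty packing, or any troubled pair, is Lemma 3.12 (`troubledPair`) — second
  branch; so the packing is empty;
* Cases 1–4: `case1_two_readers`, `case1_and_gate`, `case2`, `case3`, `case4` — second branch;
* otherwise the standing assumptions `Standing` hold and `LiYang2022_cases5to8` applies.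

Hence `LiYang2022_measure_ge`, `li_yang` follow from `LiYang2022_cases5to8`
(`li_yang_of_cases5to8`).

## References

* J. Li, T. Yang, *3.1n − o(n) circuit lower bounds for explicit functions*, STOC 2022;
  ECCC TR21-023, §4.1 (proof of Thm. 4.1).
-/

namespace Literature.Computability.Complexity

open Finset

namespace Semicircuit

variable {n : ℕ} {C : Semicircuit n} {f : (Fin n → ZMod 2) → Bool} {R : RdqSource n} {d : ℕ}
  {αφ αI αQ : ℝ} {P : Finset (Fin C.m × Fin C.m)}

/-- The first branch of the one-step claim from a one-gate simplification with `Δμ ≥ 0`. [folklore] -/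
theorem step_inl_of_simplify
    (h : ∃ (C' : Semicircuit n) (P' : Finset (Fin C'.m × Fin C'.m)), C'.Fair ∧ C'.ComputesRestr f R ∧
      C'.IsPacking P' ∧ C'.m + 1 = C.m ∧ C'.measure αφ αI αQ P' R ≤ C.measure αφ αI αQ P R) :
    (∃ (C' : Semicircuit n) (P' : Finset (Fin C'.m × Fin C'.m)),
        C'.Fair ∧ C'.ComputesRestr f R ∧ C'.IsPacking P' ∧ C'.m < C.m ∧
          C'.measure αφ αI αQ P' R ≤ C.measure αφ αI αQ P R) := by
  obtain ⟨C', P', hF', hC', hP', hm, hμ⟩ := h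
  exact ⟨C', P', hF', hC', hP', by omega, hμ⟩

/-- **A variable is never constant on the solutions of a fair circuit.** [folklore] -/
theorem not_semConst_var (hF : C.Fair) (j : Fin n) {b : Bool}
    (h : ∀ (x : Fin n → Bool) (w : Fin C.m → Bool), C.Consistent x w → x j = b) : False := by
  obtain ⟨w, hw, -⟩ := hF (fun _ => !b)
  have := h _ w hw
  revert this; cases b <;> decide

/-- **A degenerate gate of the cyclic xor-part is constant or has a constant wire**: if
`k ∈ xorPart` (`k = I_a ⊕ I_{ā} ⊕ c`) depends only on its wire `I_a`, then `k` is constant on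
all solutions, or the other wire `I_{ā}` is. [folklore] -/
theorem semConst_or_of_depOnlyOn_xorPart {k : Fin C.m} (hk : k ∈ C.xorPart) {a : Fin 2} (h : C.DepOnlyOn k a) :
    (∃ b, ∀ (x : Fin n → Bool) (w : Fin C.m → Bool), C.Consistent x w → w k = b) ∨
      ∃ b, ∀ (x : Fin n → Bool) (w : Fin C.m → Bool), C.Consistent x w → C.nodeVal x w (C.arg k a.rev) = b := by
  obtain ⟨h, hh⟩ := h
  obtain ⟨c, hc⟩ := C.isXorOp_of_mem k hk
  -- `w k = I_a ⊕ I_ā ⊕ c` and `w k = h (I_a)`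
  have key : ∀ (x : Fin n → Bool) (w : Fin C.m → Bool), C.Consistent x w →
      C.nodeVal x w (C.arg k a.rev) = ((h (C.nodeVal x w (C.arg k a)) ^^ C.nodeVal x w (C.arg k a)) ^^ c) := by
    intro x w hw
    have h1 := hw k
    rw [xorOp_apply_eq hc a (fun b => C.nodeVal x w (C.arg k b))] at h1
    have h2 := hh x w hw
    rw [h2] at h1
    revert h1
    generalize h (C.nodeVal x w (C.arg k a)) = p
    generalize C.nodeVal x w (C.arg k a) = q
    generalize C.nodeVal x w (C.arg k a.rev) = r
    cases p <;> cases q <;> cases r <;> cases c <;> decide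
  rcases bool_fn_const_or_xor h with hconst | hxor
  · -- `h` affine non-constant: `h t = t ⊕ h false`, so `I_ā` is constant
    -- (the naming of `bool_fn_const_or_xor`: first case `h false = h true`, i.e. `h` constant)
    left
    refine ⟨h false, fun x w hw => ?_⟩
    rw [hh x w hw]
    cases C.nodeVal x w (C.arg k a)
    · rfl
    · exact hconst.symm
  · right
    refine ⟨(h false ^^ c), fun x w hw => ?_⟩
    rw [key x w hw, hxor]
    generalize C.nodeVal x w (C.arg k a) = q
    cases q <;> cases h false <;> cases c <;> rfl

/-- **Case 0.3 dispatched**: a degenerate gate yields a simplification without substitution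
(`Δμ ≥ 1 - 2α_φ ≥ 0`). [cite: LiYang2022, §4.1 (Case 0.3)] -/
theorem simplify_of_depOnlyOn (hf : IsAffineDisperser f d) (hd : 2 * d + 2 ≤ R.dim) (hF : C.Fair)
    (hC : C.ComputesRestr f R) (hP : C.IsPacking P) (hφ : 0 ≤ αφ) (hφ1 : αφ ≤ 1 / 2) (hI : 0 ≤ αI) (αQ : ℝ)
    (hN : C.PreNormalized) {k : Fin C.m} {a : Fin 2} (h : C.DepOnlyOn k a) :
    ∃ (C' : Semicircuit n) (P' : Finset (Fin C'.m × Fin C'.m)), C'.Fair ∧ C'.ComputesRestr f R ∧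
      C'.IsPacking P' ∧ C'.m + 1 = C.m ∧ C'.measure αφ αI αQ P' R ≤ C.measure αφ αI αQ P R := by
  by_cases hk : k ∈ C.xorPart
  · rcases semConst_or_of_depOnlyOn_xorPart hk h with ⟨b, hb⟩ | ⟨b, hb⟩
    · obtain ⟨C', P', hF', hC', hP', hm, hμ⟩ := resynth_const_xorGate hf (by omega) hF hC hP hφ hI αQ hk hb
      exact ⟨C', P', hF', hC', hP', hm, by linarith⟩
    · -- the other wire is a constant node (excluded), a variable (never constant) or a gate of the xor-part
      cases hw : C.arg k a.rev with
      | const b' => exact absurd hw (hN.arg_ne_const k _ b')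
      | var j =>
        exfalso
        refine not_semConst_var hF j (b := b) fun x w hcw => ?_
        have := hb x w hcw; rw [hw] at this; exact this
      | gate k' =>
        have hk' : k' ∈ C.xorPart := C.mem_of_arg_eq k hk _ k' hw
        have hb' : ∀ (x : Fin n → Bool) (w : Fin C.m → Bool), C.Consistent x w → w k' = b := by
          intro x w hcw; have := hb x w hcw; rw [hw] at this; exact this
        obtain ⟨C', P', hF', hC', hP', hm, hμ⟩ := resynth_const_xorGate hf (by omega) hF hC hP hφ hI αQ hk' hb'
        exact ⟨C', P', hF', hC', hP', hm, by linarith⟩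
  · obtain ⟨h', hh'⟩ := h
    obtain ⟨C', P', hF', hC', hP', hm, hμ⟩ := eliminate_single_dependence hf hd hF hC hP hφ hI αQ hk hh'
    exact ⟨C', P', hF', hC', hP', hm, by linarith⟩

/-- **Case 0.1 dispatched**: a circuit that is not pre-normalized is simplified by one rule
(`Δμ ≥ 0`). [cite: LiYang2022, §4.1 (Case 0.1), Lemma 3.11] -/
theorem simplify_of_not_preNormalized (hf : IsAffineDisperser f d) (hd : 2 * d + 2 ≤ R.dim) (hF : C.Fair)
    (hC : C.ComputesRestr f R) (hP : C.IsPacking P) (hφ : 0 ≤ αφ) (hφ1 : αφ ≤ 1 / 2) (hI : 0 ≤ αI) (αQ : ℝ)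
    (hN : ¬ C.PreNormalized) :
    ∃ (C' : Semicircuit n) (P' : Finset (Fin C'.m × Fin C'.m)), C'.Fair ∧ C'.ComputesRestr f R ∧
      C'.IsPacking P' ∧ C'.m + 1 = C.m ∧ C'.measure αφ αI αQ P' R ≤ C.measure αφ αI αQ P R := by
  by_cases h1 : ∀ k, C.fanout (.gate k) = 0 → C.out = .gate k
  · by_cases h2 : ∀ k a b, C.arg k a ≠ .const b
    · by_cases h3 : ∀ k, C.arg k 0 ≠ C.arg k 1
      · exact absurd ⟨h1, h2, h3⟩ hN
      · push Not at h3
        obtain ⟨k₀, hco⟩ := h3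
        by_cases hu : C.arg k₀ 0 = .gate k₀
        · have hout := out_ne_of_selfTwice hf (by omega) hF hC hu (hco ▸ hu)
          obtain ⟨D₁, P₁, hF₁, hC₁, hP₁, hm₁, hμ₁⟩ := rule_selfTwice hF hC hP hu (hco ▸ hu) hout hφ hI αQ
          exact ⟨D₁, P₁, hF₁, hC₁, hP₁, hm₁, by linarith⟩
        · obtain ⟨D₁, P₁, hF₁, hC₁, hP₁, hm₁, hμ₁⟩ := rule5_any hf hd hF hC hP hco hu hφ hI αQ
          exact ⟨D₁, P₁, hF₁, hC₁, hP₁, hm₁, by linarith⟩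
    · push Not at h2
      obtain ⟨k₀, a₀, b, h₀⟩ := h2
      obtain ⟨D₁, P₁, hF₁, hC₁, hP₁, hm₁, hμ₁⟩ :=
        rule23_any hf hd hF hC hP h₀ (hF.not_reads_self_of_const h₀) hφ hI αQ
      exact ⟨D₁, P₁, hF₁, hC₁, hP₁, hm₁, by linarith⟩
  · push Not at h1
    obtain ⟨k₀, hk₀, hout⟩ := h1
    obtain ⟨D₁, P₁, hF₁, hC₁, hP₁, hm₁, hμ₁⟩ := rule1 hF hC hP hk₀ hout hφ hI αQ
    exact ⟨D₁, P₁, hF₁, hC₁, hP₁, hm₁, by linarith⟩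

/-- An ∧-type gate reading a protected variable has a reader (else it would be the output and be
trivialized by a constant substitution). [cite: LiYang2022, §4.1 (Case 1)] -/
theorem exists_reader_of_and_protected (hf : IsAffineDisperser f d) (hd : 2 * d + 2 < R.dim) (hF : C.Fair)
    (hC : C.ComputesRestr f R) (hN : C.PreNormalized) {j l : Fin n} {e : QuadEq n} (he : R.quad l = some e)
    (hr : e.Reads j) {G : Fin C.m} {a : Fin 2} (hGj : C.arg G a = .var j) (hand : IsAndOp (C.op G)) :
    ∃ (Q : Fin C.m) (a' : Fin 2), C.arg Q a' = .gate G := by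
  by_contra hno
  push Not at hno
  have h0 : C.fanout (.gate G) = 0 := (fanout_eq_zero_iff C _).mpr hno
  have hout : C.out = .gate G := hN.out_of_fanout_eq_zero G h0
  -- trivialize `G` by `x_j := b`
  obtain ⟨b, hb⟩ := exists_trivializing hand a
  let c : ZMod 2 := finTwoEquiv.symm b
  have hbc : finTwoEquiv c = b := finTwoEquiv.apply_symm_apply b
  let C₁ := C.substConst j (finTwoEquiv c)
  have hF₁ : C₁.Fair := hF.substConst j _
  have hC₁ : C₁.ComputesRestr f (RdqSource.assignProtected he hr c) := hC.substConst_assignProtected he hr c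
  have hd₁ : 2 * d ≤ (RdqSource.assignProtected he hr c).dim := by
    have := RdqSource.dim_assignProtected he hr c; omega
  have h₀ : C₁.arg G a = .const b := by
    show (C.arg G a).substConst j (finTwoEquiv c) = .const b
    rw [hGj, Node.substConst_var_self, hbc]
  have htriv : C₁.liveFn G a b false = C₁.liveFn G a b true := hb
  exact out_ne_of_trivialized hf hd₁ hF₁ hC₁ h₀ htriv (by show C.out.substConst j (finTwoEquiv c) = .gate G; rw [hout]; rfl)

end Semicircuit

/-! ### The assembly -/

open Semicircuit in
/-- **The one-step claim of Li–Yang's Theorem 4.1 from its Cases 5–8** (ECCC TR21-023, §4.1):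
Cases 0–4 are theorems of the toolkit, so `LiYang2022_step` follows from the named fact
`LiYang2022_cases5to8`. [cite: LiYang2022, proof of Thm. 4.1 (§4.1)] -/
theorem LiYang2022_step_of_cases5to8 (h5 : LiYang2022_cases5to8) : LiYang2022_step := by
  intro αφ αI αQ hφ hφ' hI hQ n d f hf C R P hF hC hP hd
  have hφ0 : 0 ≤ αφ := hφ.le
  have hφ1 : αφ ≤ 1 / 2 := hφ'.le
  have hI0 : 0 ≤ αI := hI.le
  have hQ0 : 0 ≤ αQ := hQ.le
  -- Case 0.1: pre-normalization (Rules 1, 2/3, 5)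
  by_cases hN : C.PreNormalized
  swap
  · exact Or.inl (step_inl_of_simplify (simplify_of_not_preNormalized hf (by omega) hF hC hP hφ0 hφ1 hI0 αQ hN))
  -- Case 0.1: Rule 4
  by_cases hU : ∃ G, C.Useless G
  · obtain ⟨G, hUG⟩ := hU
    have hout := out_ne_gate_of_useless hf (by omega) hF hC hN hUG
    obtain ⟨h1, Q, aQ, aG, hGQ, hQG, hshare⟩ := hUG
    obtain ⟨C', P', hF', hC', hP', hm, hμ⟩ := rule4 hF hC hP hφ0 hI0 αQ hGQ hQG hshare h1 hout
    exact Or.inl (step_inl_of_simplify ⟨C', P', hF', hC', hP', hm, by linarith⟩)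
  -- Case 0.3: non-degeneracy
  by_cases hD : ∃ (k : Fin C.m) (a : Fin 2), C.DepOnlyOn k a
  · obtain ⟨k, a, hka⟩ := hD
    exact Or.inl (step_inl_of_simplify (simplify_of_depOnlyOn hf (by omega) hF hC hP hφ0 hφ1 hI0 αQ hN hka))
  -- Case 0.4: troubled pairs (in particular a non-empty packing)
  by_cases hTP : ∃ G₁ G₂ : Fin C.m, G₁ ≠ G₂ ∧ C.Troubled G₁ ∧ C.Troubled G₂ ∧ C.Adjacent G₁ G₂
  · obtain ⟨G₁, G₂, hne, hT₁, hT₂, hadj⟩ := hTP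
    exact Or.inr (troubledPair hf hd hF hC hP hφ0 hφ1 hI0 αQ hne hT₁ hT₂ hadj)
  have hPempty : P = ∅ := by
    by_contra hne
    obtain ⟨p, hp⟩ := nonempty_of_ne_empty hne
    obtain ⟨hne', hT1, hT2, hadj⟩ := hP.1 p hp
    exact hTP ⟨_, _, hne', hT1, hT2, hadj⟩
  subst hPempty
  -- Case 1
  by_cases h1a : ∃ j, R.Protected j ∧ ∃ (k₁ k₂ : Fin C.m) (a₁ a₂ : Fin 2),
      C.arg k₁ a₁ = .var j ∧ C.arg k₂ a₂ = .var j ∧ k₁ ≠ k₂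
  · obtain ⟨j, ⟨-, l, e, he, hr⟩, k₁, k₂, a₁, a₂, hk₁, hk₂, hk⟩ := h1a
    exact Or.inr (case1_two_readers hf hd hF hC hP hφ0 hI0 αQ he hr hk ⟨a₁, hk₁⟩ ⟨a₂, hk₂⟩)
  by_cases h1b : ∃ j, R.Protected j ∧ ∃ (G : Fin C.m) (a : Fin 2), C.arg G a = .var j ∧ IsAndOp (C.op G)
  · obtain ⟨j, ⟨-, l, e, he, hr⟩, G, a, hGj, hand⟩ := h1b
    exact Or.inr (case1_and_gate hf hd hF hC hP hφ0 hI0 αQ he hr hGj hand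
      (exists_reader_of_and_protected hf hd hF hC hN he hr hGj hand))
  -- Case 2
  by_cases h2 : ∃ j, R.Protected j ∧ C.fanout (.var j) = 0
  · obtain ⟨j, ⟨-, l, e, he, hr⟩, hj0⟩ := h2
    exact Or.inr (case2 hF hC hP hφ0 hI0 hQ0 he hr hj0)
  -- Case 3
  by_cases h3 : ∃ (j : Fin n) (G : Fin C.m) (a : Fin 2), C.arg G a = .var j ∧ IsAndOp (C.op G) ∧
      4 ≤ C.fanout (.var j) + C.fanout (.gate G)
  · obtain ⟨j, G, a, hGj, hand, h4⟩ := h3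
    have hjp : ¬ R.Protected j := fun hjp => h1b ⟨j, hjp, G, a, hGj, hand⟩
    exact Or.inr (case3 hf hd hF hC hP hφ0 hI0 αQ hN hjp hGj hand h4)
  -- Case 4
  by_cases h4 : ∃ (G : Fin C.m) (x y : Fin n) (ax ay : Fin 2), ax ≠ ay ∧ C.arg G ax = .var x ∧ C.arg G ay = .var y ∧
      IsAndOp (C.op G) ∧ C.fanout (.var x) = 1
  · obtain ⟨G, x, y, ax, ay, haxy, hax, hay, hand, hx1⟩ := h4
    have hxy : x ≠ y := by
      intro hxy
      subst hxy
      have h01 : C.arg G 0 = C.arg G 1 := by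
        obtain rfl | rfl : ax = 0 ∨ ax = 1 := by fin_cases ax <;> simp
        all_goals obtain rfl | rfl : ay = 0 ∨ ay = 1 := by fin_cases ay <;> simp
        all_goals first | exact absurd rfl haxy | rw [hax, hay]
      exact hN.arg_zero_ne_arg_one G h01
    have hxu : ¬ R.Protected x := fun hp => h1b ⟨x, hp, G, ax, hax, hand⟩
    have hyu : ¬ R.Protected y := fun hp => h1b ⟨y, hp, G, ay, hay, hand⟩
    have hyfree : R.Free y := free_of_reads hC hay
    exact Or.inr (case4 hf hd hF hC hP hφ0 (by linarith) hI0 αQ hxy hax hay haxy hand hx1 hxu hyfree hyu)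
  -- the standing assumptions hold: Cases 5–8
  have hS : C.Standing R :=
    { normalized := ⟨hN, fun G hG => hU ⟨G, hG⟩⟩
      reachesOut := fun G hG => C.reachesOut_of_preNormalized hN hG
      nonDegenerate := fun k a h => hD ⟨k, a, h⟩
      no_troubled_pair := fun G₁ G₂ hne hT₁ hT₂ hadj => hTP ⟨G₁, G₂, hne, hT₁, hT₂, hadj⟩
      protected_one_reader := fun j hj k₁ k₂ a₁ a₂ h₁ h₂ => by
        by_contra hk; exact h1a ⟨j, hj, k₁, k₂, a₁, a₂, h₁, h₂, hk⟩
      protected_not_and := fun j hj G a hGj hand => h1b ⟨j, hj, G, a, hGj, hand⟩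
      protected_pos := fun j hj => Nat.one_le_iff_ne_zero.mpr fun h0 => h2 ⟨j, hj, h0⟩
      and_fanout_le := fun j G a hGj hand => by
        by_contra hlt; exact h3 ⟨j, G, a, hGj, hand, by omega⟩
      no_and_one_var := fun G x y ax ay haxy hax hay hand hx1 => h4 ⟨G, x, y, ax, ay, haxy, hax, hay, hand, hx1⟩ }
  exact h5 αφ αI αQ hφ hφ' hI hQ n d f hf C R hF hC hd hS

/-- **Li–Yang's Theorem 4.1 (as `LiYang2022_measure_ge`) from Cases 5–8.** [cite: LiYang2022, Thm. 4.1] -/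
theorem LiYang2022_measure_ge_of_cases5to8 (h5 : LiYang2022_cases5to8) : LiYang2022_measure_ge :=
  LiYang2022_measure_ge_of_step (LiYang2022_step_of_cases5to8 h5)

/-- **Li–Yang's Theorem 1.1 (`li_yang`) from Cases 5–8 of the proof of Theorem 4.1**: every
other ingredient (Lemma 3.7, Thm. 3.9, the induction of Thm. 4.1, Lemmas 3.11–3.12,
Props. 2.4–2.6, Cases 0–4) is proved. [cite: LiYang2022, Thm. 1.1, Thm. 4.1] -/
theorem li_yang_of_cases5to8 (h5 : LiYang2022_cases5to8) : li_yang :=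
  li_yang_of_step (LiYang2022_step_of_cases5to8 h5)

end Literature.Computability.Complexity
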